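import Mathlib
import HarnessLib
import Summits.Ventures.LatticeQCDFlow.Scoring.StickingFloor
import Summits.Ventures.LatticeQCDFlow.Scoring.IMHPositiveCorrelations

/-!
# The V9 floor holds for the exact chain: `τ_W(1_A) ≥ floor_W(p(A), q(A))` for exact IMH

HONEST FRAMING: exact (Metropolis-corrected) sampling algorithms for lattice gauge theory;
figures of merit are autocorrelation/cost numbers at stated couplings and volumes; no
continuum-physics claim.

Venture `LatticeQCDFlow` (cell pub-lqcd), sub-topic `Scoring`; FANOUT row 11 (`eng-scorerA`,
fitness scorer A).  NEW WORK of the cell (composition of tree results), not a published result.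

## Content

This file closes the chain of reasoning behind the frozen scorer A 0.1.2's HARD token
`V9:tau-below-sticking-floor:<k>` (score.py l.728–762) with NO remaining input:

* theory-2's T2-R′ `Exactness.sector_joint_lower_bound`: at stationarity of the exact flow-MCMC
  chain `imhKernel p q`, `P(X₀ ∈ A, X_t ∈ A) ≥ p(A) · bᵗ` with `b = (1 − q(A)/p(A))₊`;
* `Scoring.IMHPositiveCorrelations.imh_sector_autocov_nonneg`: every lag-`t` autocovariance of the
  sector indicator is `≥ 0`;
* `Scoring.StickingFloor`: the floor `½ + Σ_{t≥1} (bᵗ − p)₊/(1 − p)` and scorer A's closed form.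

Here: the autocovariance of `1_A` IS `P(X₀ ∈ A, X_t ∈ A) − p(A)²` (`autocovA_eq`, using row sums
`= 1` and stationarity of the `t`-step law), its lag-0 value is `p(A)(1 − p(A))` (`autocovA_zero`),
so the normalised ACF `ρ_t` of the sector indicator under the exact chain satisfies BOTH inputs
(`acfA_lower`, `acfA_nonneg`), hence dominates the floor's summand (`floorTerm_le_acfA`) and

* `stickingFloorWindow_le_tauIntWindow` — **for every window `W`:
  `½ + Σ_{t=1}^{W} (bᵗ − p(A))₊/(1 − p(A)) ≤ ½ + Σ_{t=1}^{W} ρ_t = τ_W(1_A)`**;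
* `stickingFloor_le_tauIntWindow` — for `0 < q(A) < p(A)` and any window `W ≥ T = ⌊log p/log b⌋`
  (the floor's series has finite support `T`): **scorer A's full floor `≤ τ_W(1_A)`**;
* `stickingFloor_le_tauInt_exact` — and `floor ≤ τ_int(1_A)` whenever the ACF is summable.

So a windowed `τ̂` of a sector indicator that lies significantly BELOW the floor is incompatible
with the chain being exact IMH from the declared model — which is what the token asserts.  (What
remains statistical: `τ̂` is an estimate with error `δτ̂`, hence the `z > 3` rule; and `p̂, q̂` are
the run's own sector frequencies.)
-/

namespace Summit.Ventures.LatticeQCDFlow.Scoring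

open Finset Literature.Probability.MarkovChains Summit.Ventures.LatticeQCDFlow.Exactness

variable {X : Type*} [Fintype X] [DecidableEq X]

/-! ### `t`-step laws: mixtures of point-mass starts, row sums, stationarity -/

/-- The `t`-step law from `μ` is the `μ`-mixture of the `t`-step laws from point masses. -/
theorem lawAt_eq_sum_single (P : X → X → ℝ) (μ : X → ℝ) :
    ∀ (t : ℕ) (y : X), lawAt P μ t y = ∑ x, μ x * lawAt P (Pi.single x 1) t y := by
  intro t
  induction t with
  | zero =>
    intro y
    simp only [lawAt_zero, Pi.single_apply, mul_ite, mul_one, mul_zero]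
    rw [Finset.sum_ite_eq]
    simp
  | succ t ih =>
    intro y
    have lhs : lawAt P μ (t + 1) y = ∑ z, ∑ x, μ x * lawAt P (Pi.single x 1) t z * P z y := by
      rw [lawAt_succ]
      unfold stepLaw
      refine sum_congr rfl fun z _ => ?_
      rw [ih z, sum_mul]
    have rhs : ∑ x, μ x * lawAt P (Pi.single x 1) (t + 1) y
        = ∑ x, ∑ z, μ x * lawAt P (Pi.single x 1) t z * P z y := by
      refine sum_congr rfl fun x _ => ?_
      rw [lawAt_succ]
      unfold stepLaw
      rw [mul_sum]
      exact sum_congr rfl fun z _ => by ring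
    rw [lhs, rhs, sum_comm]

/-- Stationarity of the `t`-step law, in point-mass form: `Σ_x π_x Pᵗ(x, y) = π_y`. -/
theorem sum_mul_lawAt_single_of_isStationary {π : X → ℝ} {P : X → X → ℝ} (h : IsStationary π P)
    (t : ℕ) (y : X) : ∑ x, π x * lawAt P (Pi.single x 1) t y = π y := by
  rw [← lawAt_eq_sum_single, lawAt_eq_self_of_isStationary h]

/-- Row sums of the `t`-step law from a point mass are `1`. -/
theorem sum_lawAt_single {P : X → X → ℝ} (hP : IsRowStochastic P) (x : X) (t : ℕ) :
    ∑ y, lawAt P (Pi.single x 1) t y = 1 := by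
  rw [sum_lawAt hP]
  simp [Pi.single_apply]

/-- The `0`-step law from a point mass. -/
theorem lawAt_single_zero (P : X → X → ℝ) (x y : X) :
    lawAt P (Pi.single x 1) 0 y = if y = x then 1 else 0 := by
  rw [lawAt_zero, Pi.single_apply]

/-! ### The sector indicator under the exact chain -/

section Sector

variable (p q : X → ℝ) (A : Finset X)

/-- Sector mass `p(A)`. -/
noncomputable def mass : ℝ := ∑ x ∈ A, p x

/-- `P(X₀ ∈ A, X_t ∈ A)` at stationarity (T2-R′'s left object). -/
noncomputable def jointA (t : ℕ) : ℝ :=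
  ∑ x ∈ A, ∑ y ∈ A, p x * lawAt (imhKernel p q) (Pi.single x 1) t y

/-- The lag-`t` autocovariance of the sector indicator `1_A` at stationarity. -/
noncomputable def autocovA (t : ℕ) : ℝ :=
  ∑ x, ∑ y, p x * lawAt (imhKernel p q) (Pi.single x 1) t y *
    ((if x ∈ A then 1 else 0) - mass p A) * ((if y ∈ A then 1 else 0) - mass p A)

/-- The normalised ACF `ρ_t = C_t / C_0` of the sector indicator. -/
noncomputable def acfA (t : ℕ) : ℝ := autocovA p q A t / autocovA p q A 0

variable {p q A}

/-- **`C_t = P(X₀ ∈ A, X_t ∈ A) − p(A)²`** (row sums `1`, stationarity, `Σ p = 1`). -/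
theorem autocovA_eq (hp : ∀ x, 0 < p x) (hp1 : ∑ x, p x = 1) (hq : ∀ x, 0 ≤ q x)
    (hq1 : ∑ x, q x = 1) (t : ℕ) :
    autocovA p q A t = jointA p q A t - mass p A ^ 2 := by
  set L : X → X → ℝ := fun x y => lawAt (imhKernel p q) (Pi.single x 1) t y with hL
  have key : ∀ x y, lawAt (imhKernel p q) (Pi.single x 1) t y = L x y := fun _ _ => rfl
  have hrow : ∀ x, ∑ y, L x y = 1 := fun x =>
    sum_lawAt_single (imhKernel_isRowStochastic hp hq hq1) x t
  have hstat : ∀ y, ∑ x, p x * L x y = p y := fun y =>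
    sum_mul_lawAt_single_of_isStationary (imhKernel_isStationary hp q) t y
  set m := mass p A with hm
  -- the four sums
  have S1 : ∑ x, ∑ y, p x * L x y * (if x ∈ A then (1 : ℝ) else 0) * (if y ∈ A then (1 : ℝ) else 0)
      = jointA p q A t := by
    unfold jointA
    rw [← sum_filter_add_sum_filter_not univ (fun x => x ∈ A)]
    have hz : ∑ x ∈ univ.filter (fun x => ¬ x ∈ A), ∑ y, p x * L x y *
        (if x ∈ A then (1 : ℝ) else 0) * (if y ∈ A then (1 : ℝ) else 0) = 0 :=
      sum_eq_zero fun x hx => by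
        have hxA : x ∉ A := (mem_filter.mp hx).2
        simp [hxA]
    rw [hz, add_zero, filter_mem_eq_inter, univ_inter]
    refine sum_congr rfl fun x hx => ?_
    rw [← sum_filter_add_sum_filter_not univ (fun y => y ∈ A)]
    have hz' : ∑ y ∈ univ.filter (fun y => ¬ y ∈ A), p x * L x y *
        (if x ∈ A then (1 : ℝ) else 0) * (if y ∈ A then (1 : ℝ) else 0) = 0 :=
      sum_eq_zero fun y hy => by
        have hyA : y ∉ A := (mem_filter.mp hy).2
        simp [hyA]
    rw [hz', add_zero, filter_mem_eq_inter, univ_inter]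
    exact sum_congr rfl fun y hy => by simp [hx, hy, hL]
  have S2 : ∑ x, ∑ y, p x * L x y * (if x ∈ A then (1 : ℝ) else 0) = m := by
    have : ∀ x, ∑ y, p x * L x y * (if x ∈ A then (1 : ℝ) else 0)
        = (if x ∈ A then p x else 0) := by
      intro x
      rw [← sum_mul, ← mul_sum, hrow x, mul_one]
      split_ifs <;> simp
    simp_rw [this]
    rw [sum_ite_mem, univ_inter, hm, mass]
  have S3 : ∑ x, ∑ y, p x * L x y * (if y ∈ A then (1 : ℝ) else 0) = m := by
    rw [sum_comm]
    have : ∀ y, ∑ x, p x * L x y * (if y ∈ A then (1 : ℝ) else 0)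
        = (if y ∈ A then p y else 0) := by
      intro y
      rw [← sum_mul, hstat y]
      split_ifs <;> simp
    simp_rw [this]
    rw [sum_ite_mem, univ_inter, hm, mass]
  have S4 : ∑ x, ∑ y, p x * L x y = 1 := by
    have : ∀ x, ∑ y, p x * L x y = p x := by
      intro x
      rw [← mul_sum, hrow x, mul_one]
    simp_rw [this]
    exact hp1
  -- expand
  have hexp : ∀ x y, p x * L x y * ((if x ∈ A then (1 : ℝ) else 0) - m) *
      ((if y ∈ A then (1 : ℝ) else 0) - m)
      = p x * L x y * (if x ∈ A then (1 : ℝ) else 0) * (if y ∈ A then (1 : ℝ) else 0)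
        - m * (p x * L x y * (if x ∈ A then (1 : ℝ) else 0))
        - m * (p x * L x y * (if y ∈ A then (1 : ℝ) else 0))
        + m ^ 2 * (p x * L x y) := by
    intro x y
    ring
  unfold autocovA
  simp_rw [key, ← hm]
  simp_rw [hexp, sum_add_distrib, sum_sub_distrib]
  have T2 : ∑ x, ∑ y, m * (p x * L x y * (if x ∈ A then (1 : ℝ) else 0)) = m * m := by
    rw [show (∑ x, ∑ y, m * (p x * L x y * (if x ∈ A then (1 : ℝ) else 0)))
        = m * ∑ x, ∑ y, p x * L x y * (if x ∈ A then (1 : ℝ) else 0) by simp_rw [mul_sum], S2]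
  have T3 : ∑ x, ∑ y, m * (p x * L x y * (if y ∈ A then (1 : ℝ) else 0)) = m * m := by
    rw [show (∑ x, ∑ y, m * (p x * L x y * (if y ∈ A then (1 : ℝ) else 0)))
        = m * ∑ x, ∑ y, p x * L x y * (if y ∈ A then (1 : ℝ) else 0) by simp_rw [mul_sum], S3]
  have T4 : ∑ x, ∑ y, m ^ 2 * (p x * L x y) = m ^ 2 := by
    rw [show (∑ x, ∑ y, m ^ 2 * (p x * L x y)) = m ^ 2 * ∑ x, ∑ y, p x * L x y by
      simp_rw [mul_sum], S4, mul_one]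
  rw [S1, T2, T3, T4]
  ring

/-- `P(X₀ ∈ A, X₀ ∈ A) = p(A)`. -/
theorem jointA_zero : jointA p q A 0 = mass p A := by
  unfold jointA mass
  refine sum_congr rfl fun x hx => ?_
  simp_rw [lawAt_single_zero, mul_ite, mul_one, mul_zero]
  rw [Finset.sum_ite_eq']
  simp [hx]

/-- **`C_0 = p(A)(1 − p(A))`**, the variance of the indicator. -/
theorem autocovA_zero (hp : ∀ x, 0 < p x) (hp1 : ∑ x, p x = 1) (hq : ∀ x, 0 ≤ q x)
    (hq1 : ∑ x, q x = 1) : autocovA p q A 0 = mass p A * (1 - mass p A) := by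
  rw [autocovA_eq hp hp1 hq hq1, jointA_zero]
  ring

/-- T2-R′ restated: `p(A) · bᵗ ≤ P(X₀ ∈ A, X_t ∈ A)`, `b = (1 − q(A)/p(A))₊`. -/
theorem mass_mul_pow_le_jointA (hp : ∀ x, 0 < p x) (hp1 : ∑ x, p x = 1) (hq : ∀ x, 0 ≤ q x)
    (hq1 : ∑ x, q x = 1) (hA : 0 < mass p A) (t : ℕ) :
    mass p A * (max 0 (1 - (∑ x ∈ A, q x) / mass p A)) ^ t ≤ jointA p q A t :=
  sector_joint_lower_bound hp hp1 hq hq1 A hA t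

/-- **Input 1 (T2-R′ in ACF form): `ρ_t ≥ (bᵗ − p(A))/(1 − p(A))`.** -/
theorem acfA_lower (hp : ∀ x, 0 < p x) (hp1 : ∑ x, p x = 1) (hq : ∀ x, 0 ≤ q x)
    (hq1 : ∑ x, q x = 1) (hA0 : 0 < mass p A) (hA1 : mass p A < 1) (t : ℕ) :
    ((max 0 (1 - (∑ x ∈ A, q x) / mass p A)) ^ t - mass p A) / (1 - mass p A)
      ≤ acfA p q A t := by
  unfold acfA
  rw [autocovA_eq hp hp1 hq hq1, autocovA_zero hp hp1 hq hq1]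
  exact acf_lower_of_joint_lower hA0 hA1 (mass_mul_pow_le_jointA hp hp1 hq hq1 hA0 t)

/-- **Input 2 (positivity): `ρ_t ≥ 0`.** -/
theorem acfA_nonneg (hp : ∀ x, 0 < p x) (hq : ∀ x, 0 ≤ q x) (hq1 : ∑ x, q x = 1) (t : ℕ) :
    0 ≤ acfA p q A t := by
  unfold acfA
  refine div_nonneg ?_ ?_
  · exact imh_sector_autocov_nonneg hp hq hq1 A (mass p A) t
  · exact imh_sector_autocov_nonneg hp hq hq1 A (mass p A) 0

/-- Hence every summand of the floor is dominated: `(bᵗ − p)₊/(1 − p) ≤ ρ_t`. -/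
theorem floorTerm_le_acfA (hp : ∀ x, 0 < p x) (hp1 : ∑ x, p x = 1) (hq : ∀ x, 0 ≤ q x)
    (hq1 : ∑ x, q x = 1) (hA0 : 0 < mass p A) (hA1 : mass p A < 1) (t : ℕ) :
    floorTerm (mass p A) (max 0 (1 - (∑ x ∈ A, q x) / mass p A)) t / (1 - mass p A)
      ≤ acfA p q A t := by
  unfold floorTerm
  rcases le_total 0 ((max 0 (1 - (∑ x ∈ A, q x) / mass p A)) ^ t - mass p A) with h | h
  · rw [max_eq_right h]
    exact acfA_lower hp hp1 hq hq1 hA0 hA1 t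
  · rw [max_eq_left h, zero_div]
    exact acfA_nonneg hp hq hq1 t

/-! ### Conclusions: windowed and full -/

/-- The WINDOWED floor `½ + Σ_{t=1}^{W} (bᵗ − p)₊/(1 − p)`. -/
noncomputable def stickingFloorWindow (p' b : ℝ) (W : ℕ) : ℝ :=
  1 / 2 + (∑ t ∈ range W, floorTerm p' b (t + 1)) / (1 - p')

/-- **For every window `W`: `floor_W(p(A), b) ≤ τ_W(1_A)`** for the exact IMH chain. -/
theorem stickingFloorWindow_le_tauIntWindow (hp : ∀ x, 0 < p x) (hp1 : ∑ x, p x = 1)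
    (hq : ∀ x, 0 ≤ q x) (hq1 : ∑ x, q x = 1) (hA0 : 0 < mass p A) (hA1 : mass p A < 1) (W : ℕ) :
    stickingFloorWindow (mass p A) (max 0 (1 - (∑ x ∈ A, q x) / mass p A)) W
      ≤ tauIntWindow (acfA p q A) W := by
  unfold stickingFloorWindow tauIntWindow
  rw [sum_div]
  have h := sum_le_sum (s := range W) fun t _ => floorTerm_le_acfA hp hp1 hq hq1 hA0 hA1 (t + 1)
  linarith

/-- Beyond its bracket index `T` the floor's series is exhausted: for `W ≥ T` (with
`b^(T+1) ≤ p ≤ bᵀ`, `0 ≤ b < 1`) the windowed floor IS the full floor. -/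
theorem stickingFloorWindow_eq_stickingFloor {p' b : ℝ} (hb0 : 0 ≤ b) (hb1 : b < 1) {T W : ℕ}
    (hT : p' ≤ b ^ T) (hT' : b ^ (T + 1) ≤ p') (hW : T ≤ W) :
    stickingFloorWindow p' b W = stickingFloor p' b := by
  have hf : ∀ t ∈ range W, t ∉ range T → floorTerm p' b (t + 1) = 0 := by
    intro t _ ht
    rw [mem_range, not_lt] at ht
    exact floorTerm_eq_zero hb0 hb1.le (Nat.lt_succ_of_le ht) hT'
  have hsum : ∑ t ∈ range W, floorTerm p' b (t + 1) = ∑ t ∈ range T, (b ^ (t + 1) - p') := by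
    rw [← sum_subset (range_mono hW) hf]
    refine sum_congr rfl fun t ht => ?_
    rw [mem_range] at ht
    exact floorTerm_eq_sub hb0 hb1.le (Nat.succ_le_of_lt ht) hT
  unfold stickingFloorWindow
  rw [hsum, stickingFloor_eq_closed hb0 hb1 hT hT', stickingFloorClosed,
    ← sum_range_pow_succ_sub hb1.ne T]

/-- **Scorer A's full floor is below the windowed `τ_W(1_A)` of the exact chain for every window
`W ≥ T = ⌊log p(A) / log b⌋`** (`0 < q(A) < p(A) < 1`, `b = 1 − q(A)/p(A)`). -/
theorem stickingFloor_le_tauIntWindow (hp : ∀ x, 0 < p x) (hp1 : ∑ x, p x = 1)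
    (hq : ∀ x, 0 ≤ q x) (hq1 : ∑ x, q x = 1) (hqA0 : 0 < ∑ x ∈ A, q x)
    (hqA : ∑ x ∈ A, q x < mass p A) (hA1 : mass p A < 1) {W : ℕ}
    (hW : ⌊Real.log (mass p A) / Real.log (1 - (∑ x ∈ A, q x) / mass p A)⌋₊ ≤ W) :
    stickingFloor (mass p A) (1 - (∑ x ∈ A, q x) / mass p A) ≤ tauIntWindow (acfA p q A) W := by
  have hA0 : 0 < mass p A := hqA0.trans hqA
  have hb0 : 0 < 1 - (∑ x ∈ A, q x) / mass p A := by
    rw [sub_pos, div_lt_one hA0]; exact hqA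
  have hb1 : 1 - (∑ x ∈ A, q x) / mass p A < 1 := by
    have := div_pos hqA0 hA0; linarith
  obtain ⟨hT, hT'⟩ := natFloor_log_div_log_spec hb0 hb1 hA0 hA1
  have hmax : max 0 (1 - (∑ x ∈ A, q x) / mass p A) = 1 - (∑ x ∈ A, q x) / mass p A :=
    max_eq_right hb0.le
  rw [← stickingFloorWindow_eq_stickingFloor hb0.le hb1 hT hT'.le hW, ← hmax]
  exact stickingFloorWindow_le_tauIntWindow hp hp1 hq hq1 hA0 hA1 W

/-- **And the floor is below `τ_int(1_A)` itself** whenever the ACF is summable (both inputs of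
`stickingFloor_le_tauInt` discharged for the exact chain). -/
theorem stickingFloor_le_tauInt_exact (hp : ∀ x, 0 < p x) (hp1 : ∑ x, p x = 1)
    (hq : ∀ x, 0 ≤ q x) (hq1 : ∑ x, q x = 1) (hA0 : 0 < mass p A) (hA1 : mass p A < 1)
    (hsum : Summable fun t : ℕ => acfA p q A (t + 1)) :
    stickingFloor (mass p A) (max 0 (1 - (∑ x ∈ A, q x) / mass p A)) ≤ tauInt (acfA p q A) :=
  stickingFloor_le_tauInt hA1 (fun t => acfA_lower hp hp1 hq hq1 hA0 hA1 (t + 1))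
    (fun t => acfA_nonneg hp hq hq1 (t + 1)) hsum

end Sector

end Summit.Ventures.LatticeQCDFlow.Scoring
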